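import Literature.Geometry.Lorentzian.Basic
import Literature.Geometry.Lorentzian.InitialData
import HarnessLib

/-!
# Route PhotonSphereChannels · crux `TameCensorship` (stmt-FinalStateConjecture-17431) · line `Sketch`, skeleton v7 ·
# stub `stub_exists_timeReverse`: the time-reversed initial data set `(h, −k)` exists

Helper file (`--supports stmt-FinalStateConjecture-17431`) of line `Sketch` (lead c3, skeleton v7, 2026-08-17). Clause (i)
of K3 (`Theses.PhotonSphereChannels.TameCensorship`: "no extremal-Kerr late chart in any MGHD") is orientation-blind, so
the v7 skeleton derives robust-(i) at an admissible datum from its FUTURE-going half at the datum and at the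
TIME-REVERSED datum `(h, −k)`. This file supplies the reversed datum: for every initial data set `D = (h, k)` on a
`3`-manifold `X` there is an initial data set `D' = (h, −k)` on `X` with the same Riemannian metric and the opposite
second fundamental form (the data induced on the same slice by the time-reversed development, whose future unit normal
is `−ν`, and `K_{−ν} = −K_ν`). The only content is the smoothness of the negated section of the bundle of bilinear forms
`Hom(TX, Hom(TX, ℝ))`, which is Mathlib's `ContMDiff.neg_section` (the one-liner of the tree's
`PseudoRiemannianMetric.neg`; the witness is built like `InitialDataSet.homothety` of
`Literature/Geometry/Lorentzian/InitialDataHomothety.lean`, with `c • k` replaced by `−k`).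

References: B. O'Neill, *Semi-Riemannian geometry* (1983), Ch. 4 (the shape tensor changes sign under `ν ↦ −ν`);
R. Bartnik, J. Isenberg, *The constraint equations*, in: The Einstein equations and the large scale behavior of
gravitational fields (2004), §2 (time-reversed data `(h, −k)`).
-/

set_option linter.dupNamespace false

open Literature.Geometry.Lorentzian
open scoped Manifold ContDiff Topology

noncomputable section

namespace Summit.FinalStateConjecture.FinalStateConjecture.Theorems.PhotonSphereChannels.TameCensorshipUnwind

/-- **Stub `stub_exists_timeReverse` of line `Sketch` (skeleton v7) for the crux `PhotonSphereChannels.TameCensorship`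
(stmt-FinalStateConjecture-17431): the time-reversed datum `(h, −k)` exists.** For every initial data set `D = (h, k)`
on a `3`-manifold `X` there is an initial data set `D'` on `X` with `D'.h = D.h` and `D'.k x v w = −D.k x v w` for all
`x`, `v`, `w`: take `D' := (h, −k)`; `−k` is symmetric because `k` is, and it is a smooth section of
`Hom(TX, Hom(TX, ℝ))` by `ContMDiff.neg_section` applied to `D.contMDiff_k`. Physically `D'` is the datum induced on the
same slice by the time-reversed development (future unit normal `−ν`, `K_{−ν} = −K_ν`; O'Neill 1983, Ch. 4;
Bartnik–Isenberg 2004, §2). [folklore] -/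
theorem stub_exists_timeReverse :
    ∀ (X : Type) [TopologicalSpace X] [ChartedSpace E3 X] [IsManifold (𝓡 3) ∞ X]
    (D : InitialDataSet (𝓡 3) X), ∃ D' : InitialDataSet (𝓡 3) X,
      D'.h = D.h ∧ ∀ (x : X) (v w : TangentSpace (𝓡 3) x), D'.k x v w = -D.k x v w := by
  intro X _ _ _ D
  exact
    ⟨{ h := D.h
       k := fun x ↦ -D.k x
       k_symm := fun x v w ↦ by
         change -(D.k x v w) = -(D.k x w v)
         rw [D.k_symm x v w]
       contMDiff_k := D.contMDiff_k.neg_section },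
      rfl, fun _ _ _ ↦ rfl⟩

end Summit.FinalStateConjecture.FinalStateConjecture.Theorems.PhotonSphereChannels.TameCensorshipUnwind
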